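import Summits.SmoothPoincare4.SmoothPoincare4.Theorems.SullivanDualWitnessChargeV15CapModelACSSmooth

/-!
# Cap model for crux `WitnessCharge`, IV: the `CapData` of the one-chart end cap (stub S2)

Assembly of `…V15CapModelGlue.lean`, `…V15CapModelTopology.lean`, `…V15CapModelCharts.lean`,
`…V15CapModelACS.lean`, `…V15CapModelACSSmooth.lean` into the interface
`CapData S p J ε'` of `Theorems/SullivanDualWitnessChargeCapDefs.lean`, and the registered stub
`stub_capModel` of skeleton v15 (line `Sketch`, lead c8): for `J` standard on the punctured
`ε'`-chart-ball, `Nonempty (CapData S p J ε')` — the manifold is the open gluing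
`(Σ ∖ p) ∪ {‖t‖ < ρ} × ℂ_σ` along `(t, σ) = (z⁻¹, w)`, `ρ = min (ε'/2) 1`, its almost complex
structure is `J` on `Σ ∖ p` and multiplication by `i` on the added line.
-/

noncomputable section

set_option linter.dupNamespace false

open scoped Manifold ContDiff Topology
open Set Filter Function Literature.Geometry.Symplectic Literature.Topology.FourManifolds
  TopologicalSpace

namespace Summit.SmoothPoincare4.SmoothPoincare4.Theorems.WitnessCharge.PencilIncompleteness

variable {S : HomotopySphere 4} {p : S.carrier} {ε' : ℝ}
variable (hε' : 0 < ε')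
  (hball : Metric.closedBall (extChartAt (𝓡 4) p p) ε' ⊆ (extChartAt (𝓡 4) p).target)
  (J : ∀ x : punctured p, TangentSpace (𝓡 4) x →L[ℝ] TangentSpace (𝓡 4) x)
  (hJ2 : ∀ (x : punctured p) (v : TangentSpace (𝓡 4) x), J x (J x v) = -v)
  (hJsmooth : ∀ x₀ : punctured p,
    ContMDiffAt (𝓡 4) 𝓘(ℝ, EuclideanSpace ℝ (Fin 4) →L[ℝ] EuclideanSpace ℝ (Fin 4)) ∞
      (inTangentCoordinates (𝓡 4) (𝓡 4) (id : punctured p → punctured p) id (fun x => J x) x₀) x₀)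
  (hJstd : ∀ x : punctured p, InPuncturedChartBall p ε' x →
    ∀ (v : TangentSpace (𝓡 4) x) (c : EuclideanSpace ℝ (Fin 4)),
      inner ℝ (fderiv ℝ inversion (extChartAt (𝓡 4) p x.1 - extChartAt (𝓡 4) p p)
        (mfderiv (𝓡 4) 𝓘(ℝ, EuclideanSpace ℝ (Fin 4))
          (fun z : punctured p => extChartAt (𝓡 4) p z.1) x (J x v))) c
      = stdSymplecticForm (fderiv ℝ inversion (extChartAt (𝓡 4) p x.1 - extChartAt (𝓡 4) p p)
        (mfderiv (𝓡 4) 𝓘(ℝ, EuclideanSpace ℝ (Fin 4))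
          (fun z : punctured p => extChartAt (𝓡 4) p z.1) x v)) c)

/-- The almost complex structure of the cap (a choice of the structure of `exists_capJX`). -/
def capJX : AlmostComplexStructure (𝓡 4) ∞ (capGlueData hε' hball).Glued :=
  Classical.choose (exists_capJX hε' hball J hJ2 hJstd hJsmooth)

/-- `capJX = capJ` pointwise. -/
theorem capJX_apply (y : (capGlueData hε' hball).Glued) :
    capJX hε' hball J hJ2 hJsmooth hJstd y = capJ hε' hball J y :=
  Classical.choose_spec (exists_capJX hε' hball J hJ2 hJstd hJsmooth) y

/-- **The `CapData` of the one-chart end cap** (all fields from files I–III). -/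
def capData : CapData S p J ε' where
  X := (capGlueData hε' hball).Glued
  t2Space := t2Space_capGlued hε' hball
  secondCountableTopology := secondCountableTopology_capGlued hε' hball
  JX := capJX hε' hball J hJ2 hJsmooth hJstd
  ι := (capGlueData hε' hball).inl
  ιinv := capIotaInv hε' hball
  capPt := capPtMap hε' hball
  capCoord := capCoordMap hε' hball
  capInv := capInvMap hε' hball
  ρ := capRadius ε'
  ρ_pos := capRadius_pos hε'
  contMDiff_ι := (capGlueData hε' hball).contMDiff_inl
  isOpenEmbedding_ι := (capGlueData hε' hball).isOpenEmbedding_inl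
  hasMFDerivAt_ι := hasMFDerivAt_inl hε' hball
  ιinv_ι := capIotaInv_inl hε' hball
  contMDiffOn_ιinv := contMDiffOn_capIotaInv hε' hball
  hasMFDerivAt_ιinv := hasMFDerivAt_capIotaInv hε' hball
  JX_ι x v := by
    rw [capJX_apply]
    exact congrArg (fun L : EuclideanSpace ℝ (Fin 4) →L[ℝ] EuclideanSpace ℝ (Fin 4) => L v)
      (capJ_inl hε' hball J x)
  range_ι_union_range_capPt := range_inl_union_range_capPtMap hε' hball
  ι_ne_capPt := inl_ne_capPtMap hε' hball
  capPt_injective := capPtMap_injective hε' hball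
  contMDiff_capPt := contMDiff_capPtMap hε' hball
  capCoord_capInv q hq := capCoordMap_capInvMap hε' hball hq
  capInv_zero := capInvMap_zero hε' hball
  capInv_flat q hq hq0 := capInvMap_flat hε' hball hq hq0
  capInv_Ycoord x hx hz := capInvMap_Ycoord hε' hball hx hz
  contMDiffOn_capInv := contMDiffOn_capInvMap hε' hball
  isOpen_capDom := isOpen_capInvMap_image hε' hball
  contMDiffOn_capCoord := contMDiffOn_capCoordMap hε' hball
  mfderiv_capInv_bijective q hq := mfderiv_capInvMap_bijective hε' hball hq
  mfderiv_capCoord_comp q hq := mfderiv_capCoordMap_comp hε' hball hq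
  JX_capInv q hq v := by
    rw [capJX_apply]
    exact capJ_capInvMap hε' hball J hJstd hq v

/-- **Stub S2 of skeleton v15 — the cap model exists.** For `J` an almost complex structure on
`Σ ∖ p` (`J² = −1`, smooth in tangent coordinates) which is standard on the punctured
`ε'`-chart-ball (`closedBall (e p) ε' ⊆ e.target`), the one-chart end cap carries the data and
properties of `CapData S p J ε'` (`capData`). -/
theorem stub_capModel :
    ∀ (S : HomotopySphere 4) (p : S.carrier)
      (J : ∀ x : punctured p, TangentSpace (𝓡 4) x →L[ℝ] TangentSpace (𝓡 4) x) (ε' : ℝ)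
      (hε' : 0 < ε')
      (hball : Metric.closedBall (extChartAt (𝓡 4) p p) ε' ⊆ (extChartAt (𝓡 4) p).target),
      (∀ (x : punctured p) (v : TangentSpace (𝓡 4) x), J x (J x v) = -v) →
      (∀ x₀ : punctured p, ContMDiffAt (𝓡 4) 𝓘(ℝ, EuclideanSpace ℝ (Fin 4) →L[ℝ] EuclideanSpace ℝ (Fin 4)) ∞
        (inTangentCoordinates (𝓡 4) (𝓡 4) (id : punctured p → punctured p) id (fun x => J x) x₀) x₀) →
      (∀ x : punctured p, InPuncturedChartBall p ε' x →
        ∀ (v : TangentSpace (𝓡 4) x) (b : EuclideanSpace ℝ (Fin 4)),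
          inner ℝ (fderiv ℝ inversion (extChartAt (𝓡 4) p x.1 - extChartAt (𝓡 4) p p)
            (mfderiv (𝓡 4) 𝓘(ℝ, EuclideanSpace ℝ (Fin 4))
              (fun z : punctured p => extChartAt (𝓡 4) p z.1) x (J x v))) b
          = stdSymplecticForm (fderiv ℝ inversion (extChartAt (𝓡 4) p x.1 - extChartAt (𝓡 4) p p)
            (mfderiv (𝓡 4) 𝓘(ℝ, EuclideanSpace ℝ (Fin 4))
              (fun z : punctured p => extChartAt (𝓡 4) p z.1) x v)) b) →
      Nonempty (CapData S p J ε') :=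
  fun _ _ J _ hε' hball hJ2 hJsmooth hJstd => ⟨capData hε' hball J hJ2 hJsmooth hJstd⟩

end Summit.SmoothPoincare4.SmoothPoincare4.Theorems.WitnessCharge.PencilIncompleteness
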